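import Summits.ABC.ABC.Theses.DefiniteXi
import HarnessLib

/-!
Stub-ideation k2 gen 12 — scratch typing of the two residual Family-2 cells (null for staffing; recorded so nobody reruns them).
-/

set_option linter.dupNamespace false

namespace Summit.ABC.ABC.Cruxes.SteinbergCore.StubIdeas2G12

open Literature.NumberTheory.EllipticCurves Literature.NumberTheory.Automorphic
open Literature.NumberTheory.EllipticCurves.ModularForms

noncomputable section

/-- prime-to-6 part. -/
def cps (n : ℕ) : ℕ := n / (ordProj[2] n * ordProj[3] n)

/-- The registered stub `P6TamagawaSplit.stub_primeToSixDegreeBound`, verbatim. -/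
def Stub : Prop :=
  ∀ ε : ℝ, 0 < ε → ∃ C : ℝ, ∀ a b : ℤ, IsCoprime a b → a * b * (a + b) ≠ 0 → ∀ (N : ℕ) [NeZero N],
    (freyCurve a b).conductorNorm ℤ = N →
    ∀ D : ModularParametrizationData (freyCurve a b) N,
      (∀ D' : ModularParametrizationData (freyCurve a b) N, D.deg ≤ D'.deg) →
      ((D.deg / (ordProj[2] D.deg * ordProj[3] D.deg) : ℕ) : ℝ) ≤ C * (N : ℝ) ^ (2 + ε)

/-- Cell (i) — WEAKEN to the radical of the prime-to-6 part of the minimal degree (support of the large primes of `deg`). -/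
def FreyCpsRadicalBound : Prop :=
  ∀ ε : ℝ, 0 < ε → ∃ C : ℝ, ∀ a b : ℤ, IsCoprime a b → a * b * (a + b) ≠ 0 → ∀ (N : ℕ) [NeZero N],
    (freyCurve a b).conductorNorm ℤ = N →
    ∀ D : ModularParametrizationData (freyCurve a b) N,
      (∀ D' : ModularParametrizationData (freyCurve a b) N, D.deg ≤ D'.deg) →
      ((∏ ℓ ∈ (D.deg / (ordProj[2] D.deg * ordProj[3] D.deg)).primeFactors, ℓ : ℕ) : ℝ) ≤ C * (N : ℝ) ^ (2 + ε)

/-- Cell (ii) — the `T`-CREDIT cut: the weakest stub-2 currency that still closes a `SteinbergCore` composition given stubs 1 and 3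
(`T = ∏_{q ∣ N} v_q(Δ_min)`; the glue then carries `T⁵` instead of `T⁴`). -/
def StubTCredit : Prop :=
  ∀ ε : ℝ, 0 < ε → ∃ C : ℝ, ∀ a b : ℤ, IsCoprime a b → a * b * (a + b) ≠ 0 → ∀ (N : ℕ) [NeZero N],
    (freyCurve a b).conductorNorm ℤ = N →
    ∀ D : ModularParametrizationData (freyCurve a b) N,
      (∀ D' : ModularParametrizationData (freyCurve a b) N, D.deg ≤ D'.deg) →
      ((D.deg / (ordProj[2] D.deg * ordProj[3] D.deg) : ℕ) : ℝ) ≤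
        C * (N : ℝ) ^ (2 + ε) *
          ((∏ q ∈ N.primeFactors, ((freyCurve a b).minimalDiscriminantNorm ℤ).factorization q : ℕ) : ℝ)

lemma prod_primeFactors_le_succ (n : ℕ) : (∏ ℓ ∈ n.primeFactors, ℓ) ≤ n + 1 := by
  rcases Nat.eq_zero_or_pos n with rfl | hn
  · simp
  · exact (Nat.le_of_dvd hn (Nat.prod_primeFactors_dvd n)).trans (Nat.le_succ n)

/-- (i) is implied by the stub (radical ≤ number, `+1` for the junk case). -/
theorem freyCpsRadicalBound_of_stub : Stub → FreyCpsRadicalBound := by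
  intro h ε hε
  obtain ⟨C, hC⟩ := h ε hε
  refine ⟨C + 1, ?_⟩
  intro a b hab hne N _ hN D hD
  have h1 := hC a b hab hne N hN D hD
  have hN1 : (1 : ℝ) ≤ (N : ℝ) ^ (2 + ε) := by
    apply Real.one_le_rpow
    · exact_mod_cast Nat.one_le_iff_ne_zero.mpr (NeZero.ne N)
    · linarith
  have h2 : ((∏ ℓ ∈ (D.deg / (ordProj[2] D.deg * ordProj[3] D.deg)).primeFactors, ℓ : ℕ) : ℝ) ≤
      ((D.deg / (ordProj[2] D.deg * ordProj[3] D.deg) : ℕ) : ℝ) + 1 := by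
    exact_mod_cast prod_primeFactors_le_succ _
  calc ((∏ ℓ ∈ (D.deg / (ordProj[2] D.deg * ordProj[3] D.deg)).primeFactors, ℓ : ℕ) : ℝ)
      ≤ ((D.deg / (ordProj[2] D.deg * ordProj[3] D.deg) : ℕ) : ℝ) + 1 := h2
    _ ≤ C * (N : ℝ) ^ (2 + ε) + 1 * (N : ℝ) ^ (2 + ε) := by
        have : (1 : ℝ) ≤ 1 * (N : ℝ) ^ (2 + ε) := by simpa using hN1
        linarith
    _ = (C + 1) * (N : ℝ) ^ (2 + ε) := by ring

/-- The stub implies (ii) whenever `T ≥ 1` (bad primes divide the minimal discriminant); stated with that as a hypothesis. -/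
theorem stubTCredit_of_stub
    (hT : ∀ a b : ℤ, IsCoprime a b → a * b * (a + b) ≠ 0 → ∀ N : ℕ, (freyCurve a b).conductorNorm ℤ = N →
      1 ≤ ∏ q ∈ N.primeFactors, ((freyCurve a b).minimalDiscriminantNorm ℤ).factorization q) :
    Stub → StubTCredit := by
  intro h ε hε
  obtain ⟨C, hC⟩ := h ε hε
  refine ⟨max C 0, ?_⟩
  intro a b hab hne N _ hN D hD
  have h1 := hC a b hab hne N hN D hD
  have hT1 : (1 : ℝ) ≤ ((∏ q ∈ N.primeFactors, ((freyCurve a b).minimalDiscriminantNorm ℤ).factorization q : ℕ) : ℝ) := by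
    exact_mod_cast hT a b hab hne N hN
  have hNpow : (0 : ℝ) ≤ (N : ℝ) ^ (2 + ε) := Real.rpow_nonneg (Nat.cast_nonneg N) _
  have hmax : C * (N : ℝ) ^ (2 + ε) ≤ max C 0 * (N : ℝ) ^ (2 + ε) :=
    mul_le_mul_of_nonneg_right (le_max_left C 0) hNpow
  have hnonneg : 0 ≤ max C 0 * (N : ℝ) ^ (2 + ε) := mul_nonneg (le_max_right C 0) hNpow
  calc ((D.deg / (ordProj[2] D.deg * ordProj[3] D.deg) : ℕ) : ℝ)
      ≤ max C 0 * (N : ℝ) ^ (2 + ε) := h1.trans hmax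
    _ = max C 0 * (N : ℝ) ^ (2 + ε) * 1 := by ring
    _ ≤ max C 0 * (N : ℝ) ^ (2 + ε) *
          ((∏ q ∈ N.primeFactors, ((freyCurve a b).minimalDiscriminantNorm ℤ).factorization q : ℕ) : ℝ) :=
        mul_le_mul_of_nonneg_left hT1 hnonneg

end

end Summit.ABC.ABC.Cruxes.SteinbergCore.StubIdeas2G12
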